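import Mathlib
import Literature.NumberTheory.Automorphic.BrandtXi

/-!
# Sketch — first lemmas of the crux idea cards for `DefiniteXi.XiBound` (stmt-ABC-11336)

Ideator 2, round 1.  Two abstract lattice lemmas over `ι → ℤ` with the Gross pairing
`⟨x, y⟩_w = Σ w_i x_i y_i` (the pairing behind `Literature.NumberTheory.Automorphic.Brandt.xi`):

* `xi_dvd_gcd_mul_index`  — card `hecke-discriminant-saturation`: the congruence number
  `ξ = ⟨φ, φ⟩_w` of a primitive line divides `γ · e` for every exponent `e` of the finite group
  `ℤ^ι / (ℤφ ⊕ M)`, `M ⊆ φ^⊥` (in the card: `M = ⊕_{g ≠ f} X_g`, `e ∣` inter-orbit index `I`).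
* `xi_dvd_content_mul_congrExponent` — card `theta-content-squeeze`: functoriality of congruence
  exponents under an integral equivariant map `Θ` (the Shintani/theta lift to weight 3/2):
  `ξ ∣ γ · c · η₀`, `c` = content of `Θ φ`, `η₀` = congruence exponent of the primitive image line.
Here `γ = gcd_i (w_i φ_i)` (divides `lcm w_i ≤ 12` for a primitive `φ`).
-/

open Finset BigOperators

namespace Summit.ABC.ABC.Cruxes.XiBound.Sketch

variable {ι κ : Type*} [Fintype ι] [Fintype κ]

/-- Pairing a basis vector: `⟨e_i, φ⟩_w = w_i φ_i`. -/
theorem pair_single [DecidableEq ι] (w : ι → ℕ) (φ : ι → ℤ) (i : ι) (t : ℤ) :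
    ∑ j, (w j : ℤ) * ((t • (Pi.single i 1 : ι → ℤ)) j) * φ j = t * ((w i : ℤ) * φ i) := by
  have : ∀ j, (w j : ℤ) * ((t • (Pi.single i 1 : ι → ℤ)) j) * φ j
      = if j = i then t * ((w i : ℤ) * φ i) else 0 := by
    intro j
    by_cases h : j = i
    · subst h; simp; ring
    · simp [h]
  rw [Finset.sum_congr rfl fun j _ => this j]
  simp

/-- `⟨a φ + m, φ⟩ = a ξ` when `m ⊥ φ`. -/
theorem pair_smul_add (w : ι → ℕ) (φ m : ι → ℤ) (a : ℤ)
    (hm : ∑ i, (w i : ℤ) * m i * φ i = 0) :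
    ∑ j, (w j : ℤ) * ((a • φ + m) j) * φ j = a * ∑ j, (w j : ℤ) * φ j * φ j := by
  have : ∑ j, (w j : ℤ) * ((a • φ + m) j) * φ j
      = a * ∑ j, (w j : ℤ) * φ j * φ j + ∑ j, (w j : ℤ) * m j * φ j := by
    rw [Finset.mul_sum, ← Finset.sum_add_distrib]
    refine Finset.sum_congr rfl fun j _ => ?_
    simp only [Pi.add_apply, Pi.smul_apply, smul_eq_mul]; ring
  rw [this, hm, add_zero]

/-- Card `hecke-discriminant-saturation`, first lemma.  If `M` is a sublattice of `ℤ^ι` that is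
`w`-orthogonal to `φ` and `e` kills `ℤ^ι/(ℤφ + M)`, then `ξ_w(φ) = Σ w_i φ_i² ∣ e · gcd_i (w_i φ_i)`.
(Proof: `e x = a φ + m` gives `e ⟨x,φ⟩ = a ξ`.) -/
theorem xi_dvd_gcd_mul_index (w : ι → ℕ) (φ : ι → ℤ) (M : Submodule ℤ (ι → ℤ))
    (hM : ∀ m ∈ M, ∑ i, (w i : ℤ) * m i * φ i = 0) (e : ℕ)
    (he : ∀ x : ι → ℤ, ∃ a : ℤ, ∃ m ∈ M, (e : ℤ) • x = a • φ + m) :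
    (∑ i, (w i : ℤ) * φ i * φ i) ∣ (e : ℤ) * Finset.univ.gcd (fun i => (w i : ℤ) * φ i) := by
  classical
  have key : ∀ i, (∑ j, (w j : ℤ) * φ j * φ j) ∣ (e : ℤ) * ((w i : ℤ) * φ i) := by
    intro i
    obtain ⟨a, m, hm, hx⟩ := he (Pi.single i 1)
    refine ⟨a, ?_⟩
    rw [← pair_single w φ i (e : ℤ), hx, pair_smul_add w φ m a (hM m hm), mul_comm]
  have hg : (e : ℤ) * Finset.univ.gcd (fun i => (w i : ℤ) * φ i)
      = Finset.univ.gcd (fun i => (e : ℤ) * ((w i : ℤ) * φ i)) := by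
    rw [Finset.gcd_mul_left, Int.normalize_coe_nat]
  rw [hg]
  exact Finset.dvd_gcd fun i _ => key i

/-- Card `theta-content-squeeze`, first lemma (functoriality of congruence exponents).
`Θ : ℤ^ι → ℤ^κ` is `ℤ`-linear, maps the `w`-orthogonal complement of `φ` into a sublattice `Yc`
with `ℚ g₀ ∩ Yc = 0`, and `Θ φ = c • g₀`; if `η₀` is an exponent of `ℤ^κ/(ℤ g₀ + Yc)` then
`ξ_w(φ) ∣ η₀ · c · gcd_i (w_i φ_i)`. -/
theorem xi_dvd_content_mul_congrExponent (w : ι → ℕ) (φ : ι → ℤ)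
    (Θ : (ι → ℤ) →ₗ[ℤ] (κ → ℤ)) (g₀ : κ → ℤ) (c : ℤ) (hΘ : Θ φ = c • g₀)
    (Yc : Submodule ℤ (κ → ℤ))
    (hperp : ∀ x : ι → ℤ, ∑ i, (w i : ℤ) * x i * φ i = 0 → Θ x ∈ Yc)
    (η₀ : ℕ) (hsplit : ∀ y : κ → ℤ, ∃ a : ℤ, (η₀ : ℤ) • y - a • g₀ ∈ Yc)
    (hfree : ∀ a : ℤ, a • g₀ ∈ Yc → a = 0) :
    (∑ i, (w i : ℤ) * φ i * φ i) ∣ (η₀ : ℤ) * c * Finset.univ.gcd (fun i => (w i : ℤ) * φ i) := by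
  classical
  set ξ : ℤ := ∑ i, (w i : ℤ) * φ i * φ i with hξ
  -- the pairing with φ as a function
  let P : (ι → ℤ) → ℤ := fun x => ∑ i, (w i : ℤ) * x i * φ i
  have hPφ : P φ = ξ := rfl
  -- for every x: ξ ∣ η₀ * c * P x
  have key : ∀ x : ι → ℤ, ξ ∣ (η₀ : ℤ) * c * P x := by
    intro x
    -- x' = ξ • x - (P x) • φ is orthogonal to φ
    have hx' : P (ξ • x - (P x) • φ) = 0 := by
      show ∑ i, (w i : ℤ) * ((ξ • x - (P x) • φ) i) * φ i = 0
      have : ∀ i, (w i : ℤ) * ((ξ • x - (P x) • φ) i) * φ i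
          = ξ * ((w i : ℤ) * x i * φ i) - (P x) * ((w i : ℤ) * φ i * φ i) := by
        intro i; simp only [Pi.sub_apply, Pi.smul_apply, smul_eq_mul]; ring
      rw [Finset.sum_congr rfl fun i _ => this i, Finset.sum_sub_distrib, ← Finset.mul_sum,
        ← Finset.mul_sum]
      show ξ * P x - P x * ξ = 0
      ring
    have h1 : Θ (ξ • x - (P x) • φ) ∈ Yc := hperp _ hx'
    have h1' : Θ (ξ • x - (P x) • φ) = ξ • Θ x - (P x * c) • g₀ := by
      rw [map_sub, map_smul, map_smul, hΘ, smul_smul]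
    obtain ⟨a, ha⟩ := hsplit (Θ x)
    -- combine: η₀ • (ξ • Θ x - (P x * c) • g₀) - ξ • (η₀ • Θ x - a • g₀) ∈ Yc
    have h2 : (η₀ : ℤ) • (ξ • Θ x - (P x * c) • g₀) - ξ • ((η₀ : ℤ) • Θ x - a • g₀) ∈ Yc :=
      Yc.sub_mem (Yc.smul_mem _ (h1' ▸ h1)) (Yc.smul_mem _ ha)
    have h3 : (η₀ : ℤ) • (ξ • Θ x - (P x * c) • g₀) - ξ • ((η₀ : ℤ) • Θ x - a • g₀)
        = (ξ * a - (η₀ : ℤ) * (P x * c)) • g₀ := by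
      simp only [smul_sub, smul_smul, sub_smul]
      abel_nf
      simp only [mul_comm]
      abel_nf
    have h4 := hfree _ (h3 ▸ h2)
    refine ⟨a, ?_⟩
    linarith [h4]
  have key' : ∀ i, ξ ∣ (η₀ : ℤ) * c * ((w i : ℤ) * φ i) := by
    intro i
    have := key (Pi.single i 1)
    have hP : P (Pi.single i 1) = (w i : ℤ) * φ i := by
      have := pair_single w φ i 1
      simpa [P, one_smul] using this
    rwa [hP] at this
  have hdiv : ξ ∣ normalize ((η₀ : ℤ) * c) * Finset.univ.gcd (fun i => (w i : ℤ) * φ i) := by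
    rw [← Finset.gcd_mul_left]
    exact Finset.dvd_gcd fun i _ => key' i
  have hassoc : Associated (normalize ((η₀ : ℤ) * c) * Finset.univ.gcd (fun i => (w i : ℤ) * φ i))
      ((η₀ : ℤ) * c * Finset.univ.gcd (fun i => (w i : ℤ) * φ i)) :=
    (normalize_associated _).mul_right _
  exact hassoc.dvd_iff_dvd_right.mp hdiv

/-- Sanity link to the tree: for a line `L = ℤ ∙ φ`, `Brandt.xi w L` is the `ℕ`-cast of the
pairing value used above. -/
example (w : ι → ℕ) (φ : ι → ℤ) (hφ : φ ≠ 0) :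
    (Literature.NumberTheory.Automorphic.Brandt.xi w (ℤ ∙ φ) : ℤ) = ∑ i, (w i : ℤ) * φ i * φ i := by
  rw [Literature.NumberTheory.Automorphic.Brandt.xi_eq_sum w hφ rfl]
  push_cast
  refine Finset.sum_congr rfl fun i _ => ?_
  rw [sq_abs]; ring

end Summit.ABC.ABC.Cruxes.XiBound.Sketch
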